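import Summits.QuantumFields.BalabanUV.Beta.FP.HorizontalBookkeepingTail

/-!
# `BalabanUV.Beta.FP.ExpLocalisedBubble` — road «FP», N7 H-route, row H2-a (exp-localised vertices): ABSTRACT POWER COUNTING OF A TWO-POINT, EXPONENTIALLY
# LOCALISED SMEARING `Σ_{x,y} c(x,y)·F(z+x−y)` OF A KERNEL WITH A LATTICE TAYLOR EXPANSION — orders zero and one, the near/far split at an abstract radius `ρ`
# ([folklore] lattice bookkeeping; nothing of the manuscripts; the H2 objects are NOT typed or touched here)

HONEST DEPENDENCY (page 1, mandatory): continuum YM on T⁴ ⇐ BetaPertH ∧ nine spine estimates (0/9 proved); BetaPertH ⇐ (D1) ∧ (D4) ∧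
CAP+tail; G-an2-4 gates asym, D1 and NE2/3/4.  HONEST FRAMING (cell contract, verbatim): «discharging `BetaPertH` makes Bałaban's UV
stability UNCONDITIONAL — a real constructive-QFT result; it is NOT the continuum limit and NOT the Clay problem.»  THIS MODULE is elementary [folklore] real
analysis on `ℤ^D`, the (b-T) engine of `FP/HorizontalBookkeepingTail` (leaf-02 g6) ONE TAYLOR ORDER UP: `FP/LatticeTaylorPath.abs_taylor0D_le`∕`abs_taylor1D_le` (g5) for the
near region, `(|s|₁/ρ)^k ≥ 1` for the far region, `FP/StencilMoments.summable_of_weight_exp` for the exponential letters.  Every analytic input (the decay of `F` and of its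
differences, the localisation of `c`) is a HYPOTHESIS displayed in the signatures; it cites nothing, defines nothing, mints no `Prop` fact, 0 sorry.  NOT the bubble of the
perfect theory (rows H2-P-*, H2-b-ALG), NOT `hgerm`, NOT `hasym`, NOT D1, NOT BetaPertH, NOT continuum, NOT Clay.

ROW (road FP owner d1-p3-g5, R-FP-17 `N7-PROOF.v3.md` §4, `LEAVES-FP.md` «H2-a»): «`Σ_{x,y} c(x,y)·F(z + x − y)` with `|c(x,y)| ≤ Ce^{−δ(‖x‖+‖y‖)}` and `F = ℓ + O(‖·‖^{−a−1})`
⟹ `(Σ c)·ℓ(z) + (first moments of c)·∇ℓ(z) + O(‖z‖^{−a−1})`-type expansion with explicit constants».  THIS FILE: the point-free half — at an abstract base point `y`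
with an abstract near radius `ρ`; the sup-norm power counting at `‖z‖∞` (choice `ρ = ⌊‖z‖∞/4⌋`, decay exponents `a`, `a+1`, `a+2`) is the next module `…BubblePoint`.

CONTENT.
* §1 `abs_sub_le_near_far_pow` (order 0, general far exponent `k`: `|F(y+s) − F y| ≤ D·B₁·|s|₁ + 2A₀·(|s|₁/ρ)^k`),
  **`abs_taylor1_le_near_far_pow`** (order 1: `|F(y+s) − F y − Σ_i s_i·Δ_iF y| ≤ D(D+1)·B₂·|s|₁² + (2A₀ + A₁|s|₁)·(|s|₁/ρ)^k`, `A₁ ≥ |Δ_iF y|`, `B₂` = second differences on the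
  box of radius `ρ` around `y`).
* §2 the exponential letters `Θ`: `summable_expWeight_pow`, `tsum_prod_expWeight_pow_le` (`Σ'_{x,y} e^{−δ|x|₁}e^{−δ|y|₁}((|x|₁+1)+(|y|₁+1))^m ≤ 2^m·(m!e^{δ/2}(2/δ)^m)·e^{δ/2}·Zl(δ/2)²`).
* §3 **`abs_smear_sub_order0_le`**, **`abs_smear_sub_order1_le`**: for a two-point weight `|c(x,y)| ≤ C·e^{−δ(|x|₁+|y|₁)}` and `F` bounded by `A₀` with `|Δ_iF y| ≤ A₁`,
  first (resp. second) differences `≤ B` on the box of radius `ρ` around `y`: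
  `|Σ'_{x,y} c(x,y)·F(y+x−y′) − (Σ' c)·F y| ≤ C·(D·B·Θ₁ + 2A₀·Θ_k/ρ^k)` and
  `|Σ'_{x,y} c(x,y)·F(y+x−y′) − (Σ' c)·F y − Σ_i m_i·Δ_iF y| ≤ C·(D(D+1)·B·Θ₂ + (2A₀·Θ_k + A₁·Θ_{k+1})/ρ^k)`, `m_i := Σ'_{x,y} c(x,y)·(x−y′)_i`; every family's
  summability PROVED (`summable_smear`, `summable_weight`, `summable_firstMoment`).
Unit `b2b-balaban-beta-d1-formalise-leaf-02` (gen 6).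
-/

noncomputable section

namespace Summit.QuantumFields.BalabanUV.Beta.FP.ExpLocalisedBubble

open Finset Filter Topology fwdDiff
open scoped BigOperators
open Literature.MathematicalPhysics.QuantumFieldTheory.Balaban1983to89
open Literature.MathematicalPhysics.QuantumFieldTheory.Balaban1983to89.Beta
open B12Sec2to5 (l1 l1_nonneg abs_coord_le_l1)
open ExpKernelCalculus (Site Zl Zl_pos l1_sub_triangle l1_sub_symm)
open Summit.QuantumFields.BalabanUV.Beta.FP.StencilMoments (summable_of_weight_exp)
open Summit.QuantumFields.BalabanUV.Beta.FP.LatticeTaylorPath (abs_taylor0D_le abs_taylor1D_le)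
open Summit.QuantumFields.BalabanUV.Beta.FP.HorizontalBookkeepingTail (l1_eq_natCast abs_apply_le_sum_natAbs)

variable {D : ℕ}

/-! ## §1 Near/far bounds of orders zero and one, general far exponent -/

/-- **ORDER ZERO, GENERAL FAR EXPONENT**: `|F| ≤ A₀`, first differences `≤ B` on the coordinate box of radius `ρ ≥ 1` around `y` ⟹ for every `s` and every `k`,
`|F (y+s) − F y| ≤ D·B·|s|₁ + 2A₀·(|s|₁/ρ)^k`. [folklore] -/
theorem abs_sub_le_near_far_pow {F : Site D → ℝ} {y : Site D} {A₀ B : ℝ} {ρ : ℕ} (hρ : 0 < ρ) (hB : 0 ≤ B) (k : ℕ)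
    (hA : ∀ t, |F t| ≤ A₀)
    (hF1 : ∀ t : Site D, (∀ i, |t i - y i| ≤ (ρ : ℤ)) → ∀ i, |F (t + Pi.single i 1) - F t| ≤ B) (s : Site D) :
    |F (y + s) - F y| ≤ (D : ℝ) * B * l1 s + 2 * A₀ * (l1 s / ρ) ^ k := by
  have hA0 : 0 ≤ A₀ := (abs_nonneg _).trans (hA y)
  have hl1 := l1_nonneg s
  have hRl1 : ((∑ i, (s i).natAbs : ℕ) : ℝ) = l1 s := (l1_eq_natCast s).symm
  by_cases hle : (∑ i, (s i).natAbs) ≤ ρ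
  · have h := abs_taylor0D_le F y s (abs_apply_le_sum_natAbs s) hB (fun x hx i =>
      hF1 x (fun j => (hx j).trans (by exact_mod_cast hle)) i)
    rw [hRl1] at h
    calc |F (y + s) - F y| ≤ (D : ℝ) * l1 s * B := h
      _ = (D : ℝ) * B * l1 s := by ring
      _ ≤ (D : ℝ) * B * l1 s + 2 * A₀ * (l1 s / ρ) ^ k := le_add_of_nonneg_right (by positivity)
  · have hρ' : (0 : ℝ) < ρ := by exact_mod_cast hρ
    have h1 : |F (y + s) - F y| ≤ 2 * A₀ := (abs_sub _ _).trans (by linarith [hA (y + s), hA y])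
    have h2 : (1 : ℝ) ≤ l1 s / ρ := by
      rw [le_div_iff₀ hρ', one_mul, ← hRl1]
      exact_mod_cast (not_le.mp hle).le
    calc |F (y + s) - F y| ≤ 2 * A₀ := h1
      _ ≤ 2 * A₀ * (l1 s / ρ) ^ k := le_mul_of_one_le_right (by positivity) (one_le_pow₀ h2)
      _ ≤ (D : ℝ) * B * l1 s + 2 * A₀ * (l1 s / ρ) ^ k := le_add_of_nonneg_left (by positivity)

/-- [folklore] `|Σ_i s_i·g_i| ≤ A₁·|s|₁` when every `|g_i| ≤ A₁`. -/
theorem abs_sum_mul_le_l1 {s : Site D} {g : Fin D → ℝ} {A₁ : ℝ} (hg : ∀ i, |g i| ≤ A₁) :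
    |∑ i, (s i : ℝ) * g i| ≤ A₁ * l1 s := by
  unfold l1
  rw [Finset.mul_sum]
  refine (Finset.abs_sum_le_sum_abs _ _).trans (Finset.sum_le_sum fun i _ => ?_)
  rw [abs_mul, mul_comm]
  exact mul_le_mul_of_nonneg_right (hg i) (abs_nonneg _)

/-- **ORDER ONE, GENERAL FAR EXPONENT**: `|F| ≤ A₀` everywhere, `|Δ_iF y| ≤ A₁` (`A₁ ≥ 0`) at the base point, second differences `≤ B` on the coordinate box of
radius `ρ ≥ 1` around `y` ⟹ for every `s` and every `k`, `|F (y+s) − F y − Σ_i s_i·Δ_iF y| ≤ D(D+1)·B·|s|₁² + (2A₀ + A₁|s|₁)·(|s|₁/ρ)^k`. [folklore] -/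
theorem abs_taylor1_le_near_far_pow {F : Site D → ℝ} {y : Site D} {A₀ A₁ B : ℝ} {ρ : ℕ} (hρ : 0 < ρ) (hB : 0 ≤ B) (hA1nn : 0 ≤ A₁) (k : ℕ)
    (hA : ∀ t, |F t| ≤ A₀) (hA1 : ∀ i, |Δ_[(Pi.single i 1 : Site D)] F y| ≤ A₁)
    (hF2 : ∀ t : Site D, (∀ i, |t i - y i| ≤ (ρ : ℤ)) →
      ∀ i j, |Δ_[(Pi.single i 1 : Site D)] (Δ_[(Pi.single j 1 : Site D)] F) t| ≤ B) (s : Site D) :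
    |F (y + s) - F y - ∑ i, (s i : ℝ) * Δ_[(Pi.single i 1 : Site D)] F y|
      ≤ (D : ℝ) * ((D : ℝ) + 1) * B * l1 s ^ 2 + (2 * A₀ + A₁ * l1 s) * (l1 s / ρ) ^ k := by
  have hA0 : 0 ≤ A₀ := (abs_nonneg _).trans (hA y)
  have hl1 := l1_nonneg s
  have hρ' : (0 : ℝ) < ρ := by exact_mod_cast hρ
  have hRl1 : ((∑ i, (s i).natAbs : ℕ) : ℝ) = l1 s := (l1_eq_natCast s).symm
  have hsum : |∑ i, (s i : ℝ) * Δ_[(Pi.single i 1 : Site D)] F y| ≤ A₁ * l1 s := abs_sum_mul_le_l1 hA1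
  have hfar0 : 0 ≤ (2 * A₀ + A₁ * l1 s) * (l1 s / ρ) ^ k := by positivity
  by_cases hle : (∑ i, (s i).natAbs) ≤ ρ
  · have h := abs_taylor1D_le F y s (abs_apply_le_sum_natAbs s) hB (fun x hx i j =>
      hF2 x (fun j' => (hx j').trans (by exact_mod_cast hle)) i j)
    rw [hRl1] at h
    calc |F (y + s) - F y - ∑ i, (s i : ℝ) * Δ_[(Pi.single i 1 : Site D)] F y| ≤ (D : ℝ) * ((D : ℝ) + 1) * l1 s ^ 2 * B := h
      _ = (D : ℝ) * ((D : ℝ) + 1) * B * l1 s ^ 2 := by ring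
      _ ≤ _ := le_add_of_nonneg_right hfar0
  · have h2 : (1 : ℝ) ≤ l1 s / ρ := by
      rw [le_div_iff₀ hρ', one_mul, ← hRl1]
      exact_mod_cast (not_le.mp hle).le
    have h1 : |F (y + s) - F y - ∑ i, (s i : ℝ) * Δ_[(Pi.single i 1 : Site D)] F y| ≤ 2 * A₀ + A₁ * l1 s := by
      refine (abs_sub _ _).trans ?_
      have := (abs_sub (F (y + s)) (F y)).trans (add_le_add (hA (y + s)) (hA y))
      linarith
    have hnn : 0 ≤ 2 * A₀ + A₁ * l1 s := by positivity
    calc |F (y + s) - F y - ∑ i, (s i : ℝ) * Δ_[(Pi.single i 1 : Site D)] F y| ≤ 2 * A₀ + A₁ * l1 s := h1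
      _ ≤ (2 * A₀ + A₁ * l1 s) * (l1 s / ρ) ^ k := le_mul_of_one_le_right hnn (one_le_pow₀ h2)
      _ ≤ _ := le_add_of_nonneg_left (by positivity)

/-! ## §2 The exponential letters -/

/-- [folklore] THE ONE-POINT LETTER: `x ↦ (|x|₁+1)^m·e^{−δ|x|₁}` is summable with `Σ' ≤ (m!·e^{δ/2}·(2/δ)^m)·Zl D (δ/2)`. -/
theorem summable_expWeight_pow {δ : ℝ} (hδ : 0 < δ) (m : ℕ) :
    Summable (fun x : Site D => (l1 x + 1) ^ m * Real.exp (-δ * l1 x))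
      ∧ ∑' x : Site D, (l1 x + 1) ^ m * Real.exp (-δ * l1 x) ≤ ((m.factorial : ℝ) * Real.exp (δ / 2) * (2 / δ) ^ m) * Zl D (δ / 2) := by
  have h := summable_of_weight_exp (q := (0 : Site D)) (k := m) (C := 1) hδ zero_le_one
    (g := fun x : Site D => (l1 x + 1) ^ m * Real.exp (-δ * l1 x)) (fun x => by
      rw [sub_zero, one_mul, abs_of_nonneg (by have := l1_nonneg x; positivity)])
  refine ⟨h.1, ?_⟩
  have e : ∑' x : Site D, (l1 x + 1) ^ m * Real.exp (-δ * l1 x) = ∑' x : Site D, |(l1 x + 1) ^ m * Real.exp (-δ * l1 x)| :=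
    tsum_congr fun x => (abs_of_nonneg (by have := l1_nonneg x; positivity)).symm
  rw [e]
  simpa only [one_mul] using h.2

/-- **THE TWO-POINT LETTER `Θ_m`**: `(x,y) ↦ e^{−δ|x|₁}·e^{−δ|y|₁}·((|x|₁+1)+(|y|₁+1))^m` is summable on `ℤ^D × ℤ^D` with
`Σ' ≤ 2^{m+1}·(m!·e^{δ/2}·(2/δ)^m)·e^{δ/2}·Zl D (δ/2)²` (power mean `(p+q)^m ≤ 2^m(p^m+q^m)` + the one-point letters). [folklore] -/
theorem tsum_prod_expWeight_pow_le {δ : ℝ} (hδ : 0 < δ) (m : ℕ) :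
    Summable (fun p : Site D × Site D => Real.exp (-δ * l1 p.1) * Real.exp (-δ * l1 p.2) * ((l1 p.1 + 1) + (l1 p.2 + 1)) ^ m)
      ∧ ∑' p : Site D × Site D, Real.exp (-δ * l1 p.1) * Real.exp (-δ * l1 p.2) * ((l1 p.1 + 1) + (l1 p.2 + 1)) ^ m
          ≤ 2 ^ (m + 1) * ((m.factorial : ℝ) * Real.exp (δ / 2) * (2 / δ) ^ m) * Real.exp (δ / 2) * Zl D (δ / 2) ^ 2 := by
  obtain ⟨hm, hmb⟩ := summable_expWeight_pow (D := D) hδ m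
  obtain ⟨h0, h0b⟩ := summable_expWeight_pow (D := D) hδ 0
  set fm : Site D → ℝ := fun x => (l1 x + 1) ^ m * Real.exp (-δ * l1 x) with hfm
  set f0 : Site D → ℝ := fun x => (l1 x + 1) ^ 0 * Real.exp (-δ * l1 x) with hf0
  have nm : 0 ≤ fm := fun x => by have := l1_nonneg x; simp only [hfm]; positivity
  have n0 : 0 ≤ f0 := fun x => by have := l1_nonneg x; simp only [hf0]; positivity
  have H1 : HasSum (fun p : Site D × Site D => fm p.1 * f0 p.2) ((∑' x, fm x) * (∑' y, f0 y)) :=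
    (hm.hasSum.mul h0.hasSum) (hm.mul_of_nonneg h0 nm n0)
  have H2 : HasSum (fun p : Site D × Site D => f0 p.1 * fm p.2) ((∑' x, f0 x) * (∑' y, fm y)) :=
    (h0.hasSum.mul hm.hasSum) (h0.mul_of_nonneg hm n0 nm)
  have HM := (H1.add H2).mul_left ((2 : ℝ) ^ m)
  have h2pow : (2 : ℝ) ^ (m - 1) ≤ (2 : ℝ) ^ m := pow_le_pow_right₀ (by norm_num) (Nat.sub_le m 1)
  -- pointwise domination by the power mean
  have hdom : ∀ p : Site D × Site D,
      Real.exp (-δ * l1 p.1) * Real.exp (-δ * l1 p.2) * ((l1 p.1 + 1) + (l1 p.2 + 1)) ^ m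
        ≤ (2 : ℝ) ^ m * (fm p.1 * f0 p.2 + f0 p.1 * fm p.2) := by
    intro p
    have hx := l1_nonneg p.1; have hy := l1_nonneg p.2
    have hpm := add_pow_le (by linarith : (0:ℝ) ≤ l1 p.1 + 1) (by linarith : (0:ℝ) ≤ l1 p.2 + 1) m
    have hpm' : ((l1 p.1 + 1) + (l1 p.2 + 1)) ^ m ≤ (2 : ℝ) ^ m * ((l1 p.1 + 1) ^ m + (l1 p.2 + 1) ^ m) :=
      hpm.trans (mul_le_mul_of_nonneg_right h2pow (by positivity))
    simp only [hfm, hf0, pow_zero, one_mul]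
    have e : (2 : ℝ) ^ m * ((l1 p.1 + 1) ^ m * Real.exp (-δ * l1 p.1) * Real.exp (-δ * l1 p.2)
        + Real.exp (-δ * l1 p.1) * ((l1 p.2 + 1) ^ m * Real.exp (-δ * l1 p.2)))
        = Real.exp (-δ * l1 p.1) * Real.exp (-δ * l1 p.2) * ((2 : ℝ) ^ m * ((l1 p.1 + 1) ^ m + (l1 p.2 + 1) ^ m)) := by ring
    rw [e]
    exact mul_le_mul_of_nonneg_left hpm' (by positivity)
  have hnn : ∀ p : Site D × Site D, 0 ≤ Real.exp (-δ * l1 p.1) * Real.exp (-δ * l1 p.2) * ((l1 p.1 + 1) + (l1 p.2 + 1)) ^ m :=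
    fun p => by have := l1_nonneg p.1; have := l1_nonneg p.2; positivity
  have hs : Summable (fun p : Site D × Site D => Real.exp (-δ * l1 p.1) * Real.exp (-δ * l1 p.2) * ((l1 p.1 + 1) + (l1 p.2 + 1)) ^ m) :=
    Summable.of_nonneg_of_le hnn hdom HM.summable
  refine ⟨hs, ?_⟩
  have hle := hs.tsum_le_tsum hdom HM.summable
  rw [HM.tsum_eq] at hle
  refine hle.trans ?_
  simp only [Nat.factorial_zero, Nat.cast_one, pow_zero, one_mul, mul_one] at h0b
  have hZ : 0 ≤ Zl D (δ / 2) := (Zl_pos (half_pos hδ)).le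
  have hfm0 : 0 ≤ ∑' x, fm x := tsum_nonneg nm
  have hf00 : 0 ≤ ∑' x, f0 x := tsum_nonneg n0
  have hprod : (∑' x, fm x) * (∑' y, f0 y) ≤ (((m.factorial : ℝ) * Real.exp (δ / 2) * (2 / δ) ^ m) * Zl D (δ / 2)) * (Real.exp (δ / 2) * Zl D (δ / 2)) :=
    mul_le_mul hmb h0b hf00 (by positivity)
  calc (2 : ℝ) ^ m * ((∑' x, fm x) * (∑' y, f0 y) + (∑' x, f0 x) * (∑' y, fm y))
      = (2 : ℝ) ^ m * 2 * ((∑' x, fm x) * (∑' y, f0 y)) := by ring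
    _ ≤ (2 : ℝ) ^ m * 2 * ((((m.factorial : ℝ) * Real.exp (δ / 2) * (2 / δ) ^ m) * Zl D (δ / 2)) * (Real.exp (δ / 2) * Zl D (δ / 2))) :=
        mul_le_mul_of_nonneg_left hprod (by positivity)
    _ = 2 ^ (m + 1) * ((m.factorial : ℝ) * Real.exp (δ / 2) * (2 / δ) ^ m) * Real.exp (δ / 2) * Zl D (δ / 2) ^ 2 := by rw [pow_succ]; ring

/-! ## §3 The smeared kernel against a two-point exponentially localised weight -/

section Smear

variable {c : Site D × Site D → ℝ} {F : Site D → ℝ} {C δ A₀ : ℝ}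

/-- [folklore] The localisation constant is nonnegative (read at the origin pair). -/
theorem nonneg_of_loc (hc : ∀ p : Site D × Site D, |c p| ≤ C * (Real.exp (-δ * l1 p.1) * Real.exp (-δ * l1 p.2))) : 0 ≤ C := by
  have h := hc (0, 0)
  have e : l1 (0 : Site D) = 0 := by unfold l1; simp
  simp only [e, mul_zero, Real.exp_zero, mul_one] at h
  exact (abs_nonneg _).trans h

/-- [folklore] `|(x − y)_i| ≤ |x − y|₁ ≤ (|x|₁+1) + (|y|₁+1)`. -/
theorem l1_sub_le_letters (x y : Site D) : l1 (x - y) ≤ (l1 x + 1) + (l1 y + 1) := by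
  have t := l1_sub_triangle x 0 y
  rw [sub_zero, l1_sub_symm 0 y, sub_zero] at t
  linarith

/-- [folklore] A two-point exponentially localised weight is summable (indeed every polynomially weighted version is). -/
theorem summable_loc_mul_pow (hδ : 0 < δ) (hc : ∀ p : Site D × Site D, |c p| ≤ C * (Real.exp (-δ * l1 p.1) * Real.exp (-δ * l1 p.2)))
    (m : ℕ) : Summable fun p : Site D × Site D => |c p| * ((l1 p.1 + 1) + (l1 p.2 + 1)) ^ m := by
  have hC := nonneg_of_loc hc
  refine Summable.of_nonneg_of_le (fun p => by have := l1_nonneg p.1; have := l1_nonneg p.2; positivity) (fun p => ?_)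
    (((tsum_prod_expWeight_pow_le (D := D) hδ m).1).mul_left C)
  have := l1_nonneg p.1; have := l1_nonneg p.2
  calc |c p| * ((l1 p.1 + 1) + (l1 p.2 + 1)) ^ m ≤ C * (Real.exp (-δ * l1 p.1) * Real.exp (-δ * l1 p.2)) * ((l1 p.1 + 1) + (l1 p.2 + 1)) ^ m :=
        mul_le_mul_of_nonneg_right (hc p) (by positivity)
    _ = C * (Real.exp (-δ * l1 p.1) * Real.exp (-δ * l1 p.2) * ((l1 p.1 + 1) + (l1 p.2 + 1)) ^ m) := by ring

/-- [folklore] … with the displayed value of the letter: `Σ' |c|·L^m ≤ C·Θ_m`, `Θ_m := 2^{m+1}·(m!e^{δ/2}(2/δ)^m)·e^{δ/2}·Zl(δ/2)²`. -/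
theorem tsum_loc_mul_pow_le (hδ : 0 < δ) (hc : ∀ p : Site D × Site D, |c p| ≤ C * (Real.exp (-δ * l1 p.1) * Real.exp (-δ * l1 p.2)))
    (m : ℕ) : ∑' p : Site D × Site D, |c p| * ((l1 p.1 + 1) + (l1 p.2 + 1)) ^ m
      ≤ C * (2 ^ (m + 1) * ((m.factorial : ℝ) * Real.exp (δ / 2) * (2 / δ) ^ m) * Real.exp (δ / 2) * Zl D (δ / 2) ^ 2) := by
  have hC := nonneg_of_loc hc
  obtain ⟨hs, hb⟩ := tsum_prod_expWeight_pow_le (D := D) hδ m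
  calc ∑' p : Site D × Site D, |c p| * ((l1 p.1 + 1) + (l1 p.2 + 1)) ^ m
      ≤ ∑' p : Site D × Site D, C * (Real.exp (-δ * l1 p.1) * Real.exp (-δ * l1 p.2) * ((l1 p.1 + 1) + (l1 p.2 + 1)) ^ m) := by
        refine (summable_loc_mul_pow hδ hc m).tsum_le_tsum (fun p => ?_) (hs.mul_left C)
        have := l1_nonneg p.1; have := l1_nonneg p.2
        calc |c p| * ((l1 p.1 + 1) + (l1 p.2 + 1)) ^ m ≤ C * (Real.exp (-δ * l1 p.1) * Real.exp (-δ * l1 p.2)) * ((l1 p.1 + 1) + (l1 p.2 + 1)) ^ m :=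
              mul_le_mul_of_nonneg_right (hc p) (by positivity)
          _ = _ := by ring
    _ = C * ∑' p : Site D × Site D, Real.exp (-δ * l1 p.1) * Real.exp (-δ * l1 p.2) * ((l1 p.1 + 1) + (l1 p.2 + 1)) ^ m := tsum_mul_left
    _ ≤ _ := mul_le_mul_of_nonneg_left hb hC

/-- [folklore] The weight itself is summable. -/
theorem summable_weight (hδ : 0 < δ) (hc : ∀ p : Site D × Site D, |c p| ≤ C * (Real.exp (-δ * l1 p.1) * Real.exp (-δ * l1 p.2))) :
    Summable c := by
  have h := summable_loc_mul_pow hδ hc 0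
  simp only [pow_zero, mul_one] at h
  exact h.of_abs

/-- [folklore] The smeared family `p ↦ c p · F (z + p.1 − p.2)` is summable for bounded `F`. -/
theorem summable_smear (hδ : 0 < δ) (hc : ∀ p : Site D × Site D, |c p| ≤ C * (Real.exp (-δ * l1 p.1) * Real.exp (-δ * l1 p.2)))
    (hA : ∀ t, |F t| ≤ A₀) (z : Site D) : Summable fun p : Site D × Site D => c p * F (z + p.1 - p.2) := by
  have hA0 : 0 ≤ A₀ := (abs_nonneg _).trans (hA z)
  have h := summable_loc_mul_pow hδ hc 0
  simp only [pow_zero, mul_one] at h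
  refine Summable.of_norm_bounded (h.mul_right A₀) (fun p => ?_)
  rw [Real.norm_eq_abs, abs_mul]
  exact mul_le_mul_of_nonneg_left (hA _) (abs_nonneg _)

/-- [folklore] The first-moment families `p ↦ c p · (p.1 − p.2)_i` are summable. -/
theorem summable_firstMoment (hδ : 0 < δ) (hc : ∀ p : Site D × Site D, |c p| ≤ C * (Real.exp (-δ * l1 p.1) * Real.exp (-δ * l1 p.2)))
    (i : Fin D) : Summable fun p : Site D × Site D => c p * ((p.1 - p.2) i : ℝ) := by
  have h := summable_loc_mul_pow hδ hc 1
  refine Summable.of_norm_bounded h (fun p => ?_)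
  rw [Real.norm_eq_abs, abs_mul, pow_one]
  refine mul_le_mul_of_nonneg_left ?_ (abs_nonneg _)
  exact (abs_coord_le_l1 (p.1 - p.2) i).trans (l1_sub_le_letters p.1 p.2)

/-- **ORDER ZERO AT AN ABSTRACT BASE POINT**: `|c| ≤ C·e^{−δ(|x|₁+|y|₁)}`, `|F| ≤ A₀`, first differences of `F` bounded by `B` on the coordinate box of radius `ρ ≥ 1`
around `z` ⟹ `|Σ'_{x,y} c(x,y)·F(z+x−y) − (Σ' c)·F z| ≤ C·(D·B·Θ₁ + 2A₀·Θ_k/ρ^k)` for every `k`, `Θ_m := 2^{m+1}(m!e^{δ/2}(2/δ)^m)e^{δ/2}Zl(δ/2)²`. [folklore] -/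
theorem abs_smear_sub_order0_le (hδ : 0 < δ) (hc : ∀ p : Site D × Site D, |c p| ≤ C * (Real.exp (-δ * l1 p.1) * Real.exp (-δ * l1 p.2)))
    (hA : ∀ t, |F t| ≤ A₀) {z : Site D} {B : ℝ} {ρ : ℕ} (hρ : 0 < ρ) (hB : 0 ≤ B) (k : ℕ)
    (hF1 : ∀ t : Site D, (∀ i, |t i - z i| ≤ (ρ : ℤ)) → ∀ i, |F (t + Pi.single i 1) - F t| ≤ B) :
    |∑' p : Site D × Site D, c p * F (z + p.1 - p.2) - (∑' p : Site D × Site D, c p) * F z|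
      ≤ C * ((D : ℝ) * B * (2 ^ (1 + 1) * (((1 : ℕ).factorial : ℝ) * Real.exp (δ / 2) * (2 / δ) ^ 1) * Real.exp (δ / 2) * Zl D (δ / 2) ^ 2)
          + 2 * A₀ / (ρ : ℝ) ^ k * (2 ^ (k + 1) * ((k.factorial : ℝ) * Real.exp (δ / 2) * (2 / δ) ^ k) * Real.exp (δ / 2) * Zl D (δ / 2) ^ 2)) := by
  have hC := nonneg_of_loc hc
  have hA0 : 0 ≤ A₀ := (abs_nonneg _).trans (hA z)
  have hρ' : (0 : ℝ) < ρ := by exact_mod_cast hρ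
  have hsm := summable_smear hδ hc hA z
  have hw := summable_weight hδ hc
  -- centred form
  have e : ∑' p : Site D × Site D, c p * F (z + p.1 - p.2) - (∑' p : Site D × Site D, c p) * F z
      = ∑' p : Site D × Site D, c p * (F (z + (p.1 - p.2)) - F z) := by
    rw [← tsum_mul_right, ← hsm.tsum_sub (hw.mul_right (F z))]
    refine tsum_congr fun p => ?_
    rw [add_sub_assoc]; ring
  rw [e]
  -- the majorant
  set T1 : ℝ := ∑' p : Site D × Site D, |c p| * ((l1 p.1 + 1) + (l1 p.2 + 1)) ^ 1 with hT1
  set Tk : ℝ := ∑' p : Site D × Site D, |c p| * ((l1 p.1 + 1) + (l1 p.2 + 1)) ^ k with hTk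
  have HM : HasSum (fun p : Site D × Site D => (D : ℝ) * B * (|c p| * ((l1 p.1 + 1) + (l1 p.2 + 1)) ^ 1)
      + 2 * A₀ / (ρ : ℝ) ^ k * (|c p| * ((l1 p.1 + 1) + (l1 p.2 + 1)) ^ k)) ((D : ℝ) * B * T1 + 2 * A₀ / (ρ : ℝ) ^ k * Tk) :=
    ((summable_loc_mul_pow hδ hc 1).hasSum.mul_left _).add ((summable_loc_mul_pow hδ hc k).hasSum.mul_left _)
  have hbound : ‖∑' p : Site D × Site D, c p * (F (z + (p.1 - p.2)) - F z)‖ ≤ (D : ℝ) * B * T1 + 2 * A₀ / (ρ : ℝ) ^ k * Tk := by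
    refine tsum_of_norm_bounded HM (fun p => ?_)
    rw [Real.norm_eq_abs, abs_mul]
    have hL := l1_sub_le_letters p.1 p.2
    have hLnn : 0 ≤ l1 (p.1 - p.2) := l1_nonneg _
    have hd := abs_sub_le_near_far_pow hρ hB k hA hF1 (p.1 - p.2)
    have hmono : (D : ℝ) * B * l1 (p.1 - p.2) + 2 * A₀ * (l1 (p.1 - p.2) / ρ) ^ k
        ≤ (D : ℝ) * B * ((l1 p.1 + 1) + (l1 p.2 + 1)) ^ 1 + 2 * A₀ / (ρ : ℝ) ^ k * ((l1 p.1 + 1) + (l1 p.2 + 1)) ^ k := by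
      rw [pow_one, div_pow, show 2 * A₀ / (ρ : ℝ) ^ k * ((l1 p.1 + 1) + (l1 p.2 + 1)) ^ k = 2 * A₀ * (((l1 p.1 + 1) + (l1 p.2 + 1)) ^ k / (ρ : ℝ) ^ k) by ring]
      gcongr
    calc |c p| * |F (z + (p.1 - p.2)) - F z| ≤ |c p| * ((D : ℝ) * B * ((l1 p.1 + 1) + (l1 p.2 + 1)) ^ 1 + 2 * A₀ / (ρ : ℝ) ^ k * ((l1 p.1 + 1) + (l1 p.2 + 1)) ^ k) :=
          mul_le_mul_of_nonneg_left (hd.trans hmono) (abs_nonneg _)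
      _ = _ := by ring
  rw [Real.norm_eq_abs] at hbound
  refine hbound.trans ?_
  have h1 := tsum_loc_mul_pow_le hδ hc 1
  have hk := tsum_loc_mul_pow_le hδ hc k
  have : 0 ≤ 2 * A₀ / (ρ : ℝ) ^ k := by positivity
  have : 0 ≤ (D : ℝ) * B := by positivity
  calc (D : ℝ) * B * T1 + 2 * A₀ / (ρ : ℝ) ^ k * Tk
      ≤ (D : ℝ) * B * (C * (2 ^ (1 + 1) * (((1 : ℕ).factorial : ℝ) * Real.exp (δ / 2) * (2 / δ) ^ 1) * Real.exp (δ / 2) * Zl D (δ / 2) ^ 2))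
        + 2 * A₀ / (ρ : ℝ) ^ k * (C * (2 ^ (k + 1) * ((k.factorial : ℝ) * Real.exp (δ / 2) * (2 / δ) ^ k) * Real.exp (δ / 2) * Zl D (δ / 2) ^ 2)) := by
        gcongr
    _ = _ := by ring

/-- **ORDER ONE AT AN ABSTRACT BASE POINT**: `|c| ≤ C·e^{−δ(|x|₁+|y|₁)}`, `|F| ≤ A₀`, `|Δ_iF z| ≤ A₁` (`A₁ ≥ 0`), second differences of `F` bounded by `B` on the
coordinate box of radius `ρ ≥ 1` around `z` ⟹ with the FIRST MOMENTS `m_i := Σ'_{x,y} c(x,y)·(x−y)_i`, for every `k`,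
`|Σ'_{x,y} c(x,y)·F(z+x−y) − (Σ' c)·F z − Σ_i m_i·Δ_iF z| ≤ C·(D(D+1)·B·Θ₂ + (2A₀·Θ_k + A₁·Θ_{k+1})/ρ^k)`. [folklore] -/
theorem abs_smear_sub_order1_le (hδ : 0 < δ) (hc : ∀ p : Site D × Site D, |c p| ≤ C * (Real.exp (-δ * l1 p.1) * Real.exp (-δ * l1 p.2)))
    (hA : ∀ t, |F t| ≤ A₀) {z : Site D} {A₁ B : ℝ} {ρ : ℕ} (hρ : 0 < ρ) (hB : 0 ≤ B) (hA1nn : 0 ≤ A₁) (k : ℕ)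
    (hA1 : ∀ i, |Δ_[(Pi.single i 1 : Site D)] F z| ≤ A₁)
    (hF2 : ∀ t : Site D, (∀ i, |t i - z i| ≤ (ρ : ℤ)) → ∀ i j, |Δ_[(Pi.single i 1 : Site D)] (Δ_[(Pi.single j 1 : Site D)] F) t| ≤ B) :
    |∑' p : Site D × Site D, c p * F (z + p.1 - p.2) - (∑' p : Site D × Site D, c p) * F z
        - ∑ i, (∑' p : Site D × Site D, c p * ((p.1 - p.2) i : ℝ)) * Δ_[(Pi.single i 1 : Site D)] F z|
      ≤ C * ((D : ℝ) * ((D : ℝ) + 1) * B * (2 ^ (2 + 1) * (((2 : ℕ).factorial : ℝ) * Real.exp (δ / 2) * (2 / δ) ^ 2) * Real.exp (δ / 2) * Zl D (δ / 2) ^ 2)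
          + (2 * A₀ * (2 ^ (k + 1) * ((k.factorial : ℝ) * Real.exp (δ / 2) * (2 / δ) ^ k) * Real.exp (δ / 2) * Zl D (δ / 2) ^ 2)
              + A₁ * (2 ^ (k + 1 + 1) * (((k + 1).factorial : ℝ) * Real.exp (δ / 2) * (2 / δ) ^ (k + 1)) * Real.exp (δ / 2) * Zl D (δ / 2) ^ 2))
            / (ρ : ℝ) ^ k) := by
  have hC := nonneg_of_loc hc
  have hA0 : 0 ≤ A₀ := (abs_nonneg _).trans (hA z)
  have hρ' : (0 : ℝ) < ρ := by exact_mod_cast hρ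
  have hsm := summable_smear hδ hc hA z
  have hw := summable_weight hδ hc
  have hfm := fun i => summable_firstMoment hδ hc i
  -- centred form
  set G : Site D → ℝ := fun s => F (z + s) - F z - ∑ i, (s i : ℝ) * Δ_[(Pi.single i 1 : Site D)] F z with hG
  have hlin : Summable fun p : Site D × Site D => ∑ i, c p * ((p.1 - p.2) i : ℝ) * Δ_[(Pi.single i 1 : Site D)] F z :=
    summable_sum fun i _ => (hfm i).mul_right _
  have e : ∑' p : Site D × Site D, c p * F (z + p.1 - p.2) - (∑' p : Site D × Site D, c p) * F z
        - ∑ i, (∑' p : Site D × Site D, c p * ((p.1 - p.2) i : ℝ)) * Δ_[(Pi.single i 1 : Site D)] F z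
      = ∑' p : Site D × Site D, c p * G (p.1 - p.2) := by
    have e3 : ∑ i, (∑' p : Site D × Site D, c p * ((p.1 - p.2) i : ℝ)) * Δ_[(Pi.single i 1 : Site D)] F z
        = ∑' p : Site D × Site D, ∑ i, c p * ((p.1 - p.2) i : ℝ) * Δ_[(Pi.single i 1 : Site D)] F z := by
      rw [Summable.tsum_finsetSum (fun i _ => (hfm i).mul_right _)]
      refine Finset.sum_congr rfl fun i _ => ?_
      rw [← tsum_mul_right]
    rw [e3, ← tsum_mul_right, ← hsm.tsum_sub (hw.mul_right (F z)), ← Summable.tsum_sub (hsm.sub (hw.mul_right (F z))) hlin]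
    refine tsum_congr fun p => ?_
    simp only [hG]
    rw [show z + p.1 - p.2 = z + (p.1 - p.2) from add_sub_assoc z p.1 p.2, mul_sub, mul_sub, Finset.mul_sum]
    congr 1
    exact Finset.sum_congr rfl fun i _ => by ring
  rw [e]
  -- the majorant
  set T2 : ℝ := ∑' p : Site D × Site D, |c p| * ((l1 p.1 + 1) + (l1 p.2 + 1)) ^ 2 with hT2
  set Tk : ℝ := ∑' p : Site D × Site D, |c p| * ((l1 p.1 + 1) + (l1 p.2 + 1)) ^ k with hTk
  set Tk1 : ℝ := ∑' p : Site D × Site D, |c p| * ((l1 p.1 + 1) + (l1 p.2 + 1)) ^ (k + 1) with hTk1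
  have HM : HasSum (fun p : Site D × Site D => (D : ℝ) * ((D : ℝ) + 1) * B * (|c p| * ((l1 p.1 + 1) + (l1 p.2 + 1)) ^ 2)
      + (2 * A₀ / (ρ : ℝ) ^ k * (|c p| * ((l1 p.1 + 1) + (l1 p.2 + 1)) ^ k)
        + A₁ / (ρ : ℝ) ^ k * (|c p| * ((l1 p.1 + 1) + (l1 p.2 + 1)) ^ (k + 1))))
      ((D : ℝ) * ((D : ℝ) + 1) * B * T2 + (2 * A₀ / (ρ : ℝ) ^ k * Tk + A₁ / (ρ : ℝ) ^ k * Tk1)) :=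
    ((summable_loc_mul_pow hδ hc 2).hasSum.mul_left _).add
      (((summable_loc_mul_pow hδ hc k).hasSum.mul_left _).add ((summable_loc_mul_pow hδ hc (k + 1)).hasSum.mul_left _))
  have hbound : ‖∑' p : Site D × Site D, c p * G (p.1 - p.2)‖
      ≤ (D : ℝ) * ((D : ℝ) + 1) * B * T2 + (2 * A₀ / (ρ : ℝ) ^ k * Tk + A₁ / (ρ : ℝ) ^ k * Tk1) := by
    refine tsum_of_norm_bounded HM (fun p => ?_)
    rw [Real.norm_eq_abs, abs_mul]
    have hL := l1_sub_le_letters p.1 p.2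
    have hLnn : 0 ≤ l1 (p.1 - p.2) := l1_nonneg _
    have hd := abs_taylor1_le_near_far_pow hρ hB hA1nn k hA hA1 hF2 (p.1 - p.2)
    set L : ℝ := (l1 p.1 + 1) + (l1 p.2 + 1) with hLdef
    have hLpos : 0 ≤ L := by rw [hLdef]; linarith [l1_nonneg p.1, l1_nonneg p.2]
    have hmono : (D : ℝ) * ((D : ℝ) + 1) * B * l1 (p.1 - p.2) ^ 2 + (2 * A₀ + A₁ * l1 (p.1 - p.2)) * (l1 (p.1 - p.2) / ρ) ^ k
        ≤ (D : ℝ) * ((D : ℝ) + 1) * B * L ^ 2 + (2 * A₀ + A₁ * L) * (L / ρ) ^ k := by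
      refine add_le_add (mul_le_mul_of_nonneg_left (pow_le_pow_left₀ hLnn hL 2) (by positivity)) ?_
      refine mul_le_mul (by nlinarith [mul_le_mul_of_nonneg_left hL hA1nn]) ?_ (by positivity) ?_
      · exact pow_le_pow_left₀ (div_nonneg hLnn hρ'.le) (div_le_div_of_nonneg_right hL hρ'.le) k
      · exact add_nonneg (by positivity) (mul_nonneg hA1nn hLpos)
    have esplit : (2 * A₀ + A₁ * L) * (L / ρ) ^ k = 2 * A₀ / (ρ : ℝ) ^ k * L ^ k + A₁ / (ρ : ℝ) ^ k * L ^ (k + 1) := by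
      rw [div_pow, pow_succ]; ring
    calc |c p| * |G (p.1 - p.2)| ≤ |c p| * ((D : ℝ) * ((D : ℝ) + 1) * B * L ^ 2 + (2 * A₀ + A₁ * L) * (L / ρ) ^ k) :=
          mul_le_mul_of_nonneg_left (hd.trans hmono) (abs_nonneg _)
      _ = _ := by rw [esplit]; ring
  rw [Real.norm_eq_abs] at hbound
  refine hbound.trans ?_
  have h2 := tsum_loc_mul_pow_le hδ hc 2
  have hk := tsum_loc_mul_pow_le hδ hc k
  have hk1 := tsum_loc_mul_pow_le hδ hc (k + 1)
  have : 0 ≤ 2 * A₀ / (ρ : ℝ) ^ k := by positivity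
  have : 0 ≤ A₁ / (ρ : ℝ) ^ k := by positivity
  have : 0 ≤ (D : ℝ) * ((D : ℝ) + 1) * B := by positivity
  calc (D : ℝ) * ((D : ℝ) + 1) * B * T2 + (2 * A₀ / (ρ : ℝ) ^ k * Tk + A₁ / (ρ : ℝ) ^ k * Tk1)
      ≤ (D : ℝ) * ((D : ℝ) + 1) * B * (C * (2 ^ (2 + 1) * (((2 : ℕ).factorial : ℝ) * Real.exp (δ / 2) * (2 / δ) ^ 2) * Real.exp (δ / 2) * Zl D (δ / 2) ^ 2))
        + (2 * A₀ / (ρ : ℝ) ^ k * (C * (2 ^ (k + 1) * ((k.factorial : ℝ) * Real.exp (δ / 2) * (2 / δ) ^ k) * Real.exp (δ / 2) * Zl D (δ / 2) ^ 2))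
          + A₁ / (ρ : ℝ) ^ k * (C * (2 ^ (k + 1 + 1) * (((k + 1).factorial : ℝ) * Real.exp (δ / 2) * (2 / δ) ^ (k + 1)) * Real.exp (δ / 2) * Zl D (δ / 2) ^ 2))) := by
        gcongr
    _ = _ := by ring

end Smear

end Summit.QuantumFields.BalabanUV.Beta.FP.ExpLocalisedBubble

end
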